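/-
Origin: expansion seat `planner-pub-hodgecm-pv13-g4-0`, handover #6 v2 2026-08-18T11:17:11Z (md5 6d0063d72eed60ce4db07a48818e96c9 SUPERSEDES 0a8c62ef, doc-only; NO import rewrite — imports tree HodgeCM.PerL34.GenuineThetaInput only; RUN 29 or 28 at packager's discretion; independent of #2-#5; land BEFORE pv07-g4 GenuineSchrodingerCoeff) (`HOME/pub-hodgecm-pv13-g4/lean/Pv13g4/GenuineSchrodingerModel.lean`, md5 6d0063d7, 594 lines);
landed by the gen-8 packager in gate run 29 as `HodgeCM/PerL34/GenuineSchrodingerModel.lean` (verbatim).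
-/
import Summits.HodgeConjecture.HodgeCM.PerL34.GenuineThetaInput

/-!
# The genuine global split Schrödinger model: NON-VACUITY of the S3 input `GenuineThetaInput`

pub-hodgecm-pv13-g4 · file #6 · intended tree path `HodgeCM/PerL34/GenuineSchrodingerModel.lean` (NEW leaf; imports
only the landed `HodgeCM.PerL34.GenuineThetaInput` of pv09-g5).  PerL v5 Lemma 4.2(b), tex ll. 600–616 (the theta kernel
`θ_φ` on `U(1)(𝔸_{L⁺})` with `φ = ⊗_v φ_v`, `φ_v = 1_{𝒪_v³}` at the split places `v` of `L⁺ = L ∩ ℝ`, read in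
`(L⁺_v)³` through `L_{0,v}^× ≅ U(1)_v`, tex l. 610).

WHAT THIS FILE CONSTRUCTS (kernel-checked, no hypotheses beyond `L` CM):
* §1 `Space L = Πʳ_{v split} [(L⁺_v)³, 𝒪_v³]` — Mathlib's `RestrictedProduct` over the split places of `L⁺` with respect to
  the compact open subgroups `𝒪_v³ = closedBall 0 1` — a locally compact Hausdorff additive topological group (no
  second-countability is needed or claimed) with its Borel σ-algebra; the box `∏_v 𝒪_v³` as a `PositiveCompacts`; the Haar measure `μ L` (`vol(box) = 1`).
* §2 the action of the model group `Model L ≅ U(1)(𝔸_{L⁺})` (pv09-g3/g4/g5) on `Space L` through the split base charts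
  `baseTriv : U(1)_v ≃ (L⁺_v)ˣ` (`RestrictedProduct.mapAlong`; almost every coordinate of `k` is a unit of norm one, so
  `𝒪_v³` is preserved eventually), `DistribMulAction` + `ContinuousConstSMul`; whence **the global split Schrödinger
  representation** `rep L ν := dilationRep (μ L) ν` (pv07-g2's `dilationRep`, general §1) on `L²(Space L)`.
* §3 SLICES: `μ L` restricted to the cylinder over `v` and pushed to the `v`-coordinate is translation invariant, finite on
  compacts and gives `𝒪_v³` mass one, hence IS pv07-g2's `Adic.muV L⁺ v` (`addHaarMeasure_eq_iff`); so the coordinate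
  map is `MeasurePreserving`, and the module of `Space L` at an element supported at `v` is the local module
  (`distribHaarChar_eq`, via `distribHaarChar_eq_of_measure_smul_eq_mul` on the box).
* §4 extension by zero `L²(μ|_s) ↪ L²(μ)` (a linear isometry) and **the coordinate intertwiners**
  `V_v : L²((L⁺_v)³, dx_v) ↪ L²(Space L)`, `V_v f = 1_{cyl v} · (f ∘ x_v)` (`= f ⊗ ⊗_{w ≠ v} 1_{𝒪_w³}`), with the
  EQUIVARIANCE `rep(ι_v g) (V_v f) = V_v (dilationRep (muV v) 1 (baseTriv g) f)` (`rep_mulSingle_V`) and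
  `V_v 1_{𝒪_v³} = φ⁰ := 1_{box}` (`V_ballIndicator`); non-split local groups act trivially (`rep_mulSingle_of_not_isSplitPlace`).
* §5 **`thetaInputOfNonsplit`**: for every finite set `S` of NON-SPLIT places of `L⁺` and every character `χ` of the model
  group trivial on `ι_v(U(1)_v)`, `v ∈ S`, a term of pv09-g5's `GenuineThetaInput L S (Lp ℂ 2 (μ L)) (rep L 1) φ⁰ χ`
  (`ν_v = 1`, `VU_v = V_v`; the split-`v ∈ S` fields are vacuous; `hiso` on `S` is `hχ`); `thetaInput` = the case `S = ∅`
  (every `χ`); `nonempty_thetaInput_of_nonsplit`, `nonempty_thetaInput`; `‖φ⁰‖ = 1` (`norm_phi0`).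

WHAT IT ADDS TO THE ADJUDICATION.  Runs 27/28 (pv09-g5 #1–#3, pv13-g4 #3–#5) reduced the representation side of S3 to ONE
named input structure; LEMMAS v17 (4) records that what the runs add there is NON-VACUITY, not the instance.  This file is
the non-vacuity witness: the sixteen representation-side binders of `exists_compactDomain_thetaLift_ne_zero_genuine_base`
are SIMULTANEOUSLY satisfiable by an honest global object (the restricted tensor product `⊗'_v L²((L⁺_v)³)` realised as
`L²` of the restricted product, the product measure realising `⊗'`), for every CM field `L`.  WHAT IT DOES NOT GIVE: the
input at a set `S` containing split places with a ball `D_v ∌ 0` (needs `φ` with `v`-component `1_{D_v}` — same method,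
not done here), and `hiso` for `χ` NON-trivial at the non-split places of `S` (that is the genuine local Weil
representation at inert/ramified/infinite places — N31a PRINT, pv12 lineage; in this model those local groups act
trivially, so `hiso` there is exactly `χ(ι_v g) = 1`).

Inputs consumed BY NAME (all landed): `HodgeCM.PerL34.PureTensor.GenuineThetaInput` (pv09-g5),
`LocalFactors.DilationModel.{dilationRep, coeFn_dilationRep, weight, quasiMeasurePreserving_smul', Adic.muV,
Adic.integerCube, ballIndicator, Adic.nontriviallyNormedField, Adic.properSpace}` (pv07-g2),
`IdelicTorusModel.Genuine.{basePlaceOf, baseTriv, mem_genLevel_iff_norm_baseTriv_eq_one, IsSplitPlace}`, `genLevel`,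
`GenuineSetUp.Model` (pv09-g3/g4/g5); Mathlib `RestrictedProduct.{mapAlong, structureMap, isOpen_forall_mem, single,
mulSingle}`, `addHaarMeasure`, `distribHaarChar`, `Lp.compMeasurePreservingₗᵢ`.  No PerL / QW8 / 2001 claim is cited.
-/

set_option linter.unusedSectionVars false
set_option linter.unusedVariables false
set_option linter.style.longLine false
set_option linter.style.header false
set_option linter.style.cdot false
set_option linter.style.setOption false
set_option linter.style.multiGoal false
set_option linter.flexible false
set_option autoImplicit false

noncomputable section

open MeasureTheory MeasureTheory.Measure Set Metric Function Complex ComplexConjugate Topology Filter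
open scoped RestrictedProduct InnerProductSpace NNReal ENNReal Pointwise

namespace HodgeCM.PerL34.PureTensor

open HodgeCM.PerL34.LocalFactors HodgeCM.PerL34.LocalFactors.DilationModel
open HodgeCM.PerL34.IdelePlaces HodgeCM.PerL34.RestrictedRegroup HodgeCM.PerL34.RestrictedCutout
open HodgeCM.PerL34.IdelicTorusModel HodgeCM.PerL34.IdelicTorusModel.Genuine NumberField IsDedekindDomain

attribute [local instance] LocalFactors.DilationModel.Adic.nontriviallyNormedField
  LocalFactors.DilationModel.Adic.properSpace

namespace SchrodingerModel

variable (L : Type) [Field L] [NumberField L] [IsCMField L]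

local notation3 "L⁺" => maximalRealSubfield L

/-- the index set of the global split Schrödinger space: the places of `L⁺` split in `L` -/
abbrev SplitIdx : Type := {i : Place L⁺ // IsSplitPlace L i}

/-- the local coordinate space `(L⁺_v)³` at a split index -/
abbrev Coord (i : SplitIdx L) : Type := Fin 3 → (basePlaceOf L i.1).adicCompletion L⁺

/-- (Ported verbatim from the HodgeCMPerL package; no docstring in the source.) -/
instance (i : SplitIdx L) : IsUltrametricDist (Coord L i) := inferInstance

/-- the integer cube `𝒪_v³ = closedBall 0 1 ⊂ (L⁺_v)³` as an OPEN additive subgroup (ultrametric) -/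
def cube (i : SplitIdx L) : OpenAddSubgroup (Coord L i) :=
  IsUltrametricDist.closedBall_openAddSubgroup (Coord L i) one_pos

/-- (Ported verbatim from the HodgeCMPerL package; no docstring in the source.) -/
theorem coe_cube (i : SplitIdx L) : (cube L i : Set (Coord L i)) = closedBall (0 : Coord L i) 1 := rfl

/-- (Ported verbatim from the HodgeCMPerL package; no docstring in the source.) -/
theorem mem_cube_iff (i : SplitIdx L) (x : Coord L i) : x ∈ cube L i ↔ ‖x‖ ≤ 1 := by
  rw [← SetLike.mem_coe, coe_cube, mem_closedBall, dist_zero_right]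

/-- (Ported verbatim from the HodgeCMPerL package; no docstring in the source.) -/
instance fact_isOpen_cube : Fact (∀ i : SplitIdx L, IsOpen (cube L i : Set (Coord L i))) :=
  ⟨fun i => (cube L i).isOpen⟩

/-- (Ported verbatim from the HodgeCMPerL package; no docstring in the source.) -/
theorem isCompact_cube (i : SplitIdx L) : IsCompact (cube L i : Set (Coord L i)) := by
  rw [coe_cube]; exact isCompact_closedBall _ _

/-- (Ported verbatim from the HodgeCMPerL package; no docstring in the source.) -/
instance compactSpace_cube (i : SplitIdx L) : CompactSpace (cube L i) :=
  isCompact_iff_compactSpace.mp (isCompact_cube L i)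

/-- (Ported verbatim from the HodgeCMPerL package; no docstring in the source.) -/
instance compactSpace_coe_cube (i : SplitIdx L) : CompactSpace (cube L i : Set (Coord L i)) :=
  isCompact_iff_compactSpace.mp (isCompact_cube L i)

/-- **the global split Schrödinger space** `X = Πʳ_{v split} [(L⁺_v)³, 𝒪_v³]` -/
abbrev Space : Type := Πʳ i : SplitIdx L, [Coord L i, cube L i]

example : AddCommGroup (Space L) := inferInstance
example : TopologicalSpace (Space L) := inferInstance
example : IsTopologicalAddGroup (Space L) := inferInstance
example : LocallyCompactSpace (Space L) := inferInstance
example : T2Space (Space L) := inferInstance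

/-- (Ported verbatim from the HodgeCMPerL package; no docstring in the source.) -/
instance measurableSpace : MeasurableSpace (Space L) := borel (Space L)
/-- (Ported verbatim from the HodgeCMPerL package; no docstring in the source.) -/
instance borelSpace : BorelSpace (Space L) := ⟨rfl⟩

/-- the box `∏_v 𝒪_v³ ⊂ X`: compact (image of the compact `∏_v 𝒪_v³` under the structure map) and open -/
theorem isOpen_boxSet : IsOpen {x : Space L | ∀ i, x.1 i ∈ (cube L i : Set (Coord L i))} :=
  RestrictedProduct.isOpen_forall_mem (fact_isOpen_cube L).out

/-- (Ported verbatim from the HodgeCMPerL package; no docstring in the source.) -/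
theorem isCompact_boxSet : IsCompact {x : Space L | ∀ i, x.1 i ∈ (cube L i : Set (Coord L i))} := by
  have h := isCompact_range (RestrictedProduct.isEmbedding_structureMap (R := Coord L)
    (A := fun i => (cube L i : Set (Coord L i))) (𝓕 := cofinite)).continuous
  rwa [RestrictedProduct.range_structureMap] at h

/-- (Ported verbatim from the HodgeCMPerL package; no docstring in the source.) -/
def box : TopologicalSpace.PositiveCompacts (Space L) where
  carrier := {x : Space L | ∀ i, x.1 i ∈ (cube L i : Set (Coord L i))}
  isCompact' := isCompact_boxSet L
  interior_nonempty' := ⟨0, by rw [(isOpen_boxSet L).interior_eq]; exact fun i => zero_mem (cube L i)⟩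

/-- (Ported verbatim from the HodgeCMPerL package; no docstring in the source.) -/
theorem coe_box : (box L : Set (Space L)) = {x : Space L | ∀ i, x.1 i ∈ (cube L i : Set (Coord L i))} := rfl

/-- (Ported verbatim from the HodgeCMPerL package; no docstring in the source.) -/
theorem mem_box_iff (x : Space L) : x ∈ (box L : Set (Space L)) ↔ ∀ i, x i ∈ cube L i := Iff.rfl

/-- (Ported verbatim from the HodgeCMPerL package; no docstring in the source.) -/
theorem isOpen_box : IsOpen (box L : Set (Space L)) := isOpen_boxSet L

/-- the Haar measure `dx = ⊗_v dx_v` on `X`, normalised by `vol(∏_v 𝒪_v³) = 1` -/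
def μ : Measure (Space L) := addHaarMeasure (box L)

/-- (Ported verbatim from the HodgeCMPerL package; no docstring in the source.) -/
instance isAddHaarMeasure_μ : (μ L).IsAddHaarMeasure := by unfold μ; infer_instance
/-- (Ported verbatim from the HodgeCMPerL package; no docstring in the source.) -/
instance regular_μ : (μ L).Regular := by unfold μ; infer_instance

/-- (Ported verbatim from the HodgeCMPerL package; no docstring in the source.) -/
theorem μ_box : μ L (box L) = 1 := by rw [μ]; exact addHaarMeasure_self

/-! ## §2  The action of the model group `U(1)(𝔸_{L⁺}) = Model L` on `X` through the split base charts -/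

variable {L}

/-- the split component of `k ∈ U(1)(𝔸_{L⁺})` at a split index, read in `(L⁺_v)ˣ` through `baseTriv` -/
def unitAt (k : Model L) (i : SplitIdx L) : ((basePlaceOf L i.1).adicCompletion L⁺)ˣ := baseTriv L i.1 i.2 (k i.1)

/-- (Ported verbatim from the HodgeCMPerL package; no docstring in the source.) -/
@[simp] theorem unitAt_one (i : SplitIdx L) : unitAt (1 : Model L) i = 1 := by
  simp [unitAt]

/-- (Ported verbatim from the HodgeCMPerL package; no docstring in the source.) -/
@[simp] theorem unitAt_mul (k k' : Model L) (i : SplitIdx L) : unitAt (k * k') i = unitAt k i * unitAt k' i := by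
  simp [unitAt]

/-- (Ported verbatim from the HodgeCMPerL package; no docstring in the source.) -/
theorem unitAt_mulSingle_self [DecidableEq (Place L⁺)] (i : SplitIdx L) (g : locTorus L⁺ L i.1) :
    unitAt (RestrictedProduct.mulSingle (genLevel L) i.1 g) i = baseTriv L i.1 i.2 g := by
  simp [unitAt]

/-- (Ported verbatim from the HodgeCMPerL package; no docstring in the source.) -/
theorem unitAt_mulSingle_of_ne [DecidableEq (Place L⁺)] {i : Place L⁺} (j : SplitIdx L) (h : j.1 ≠ i)
    (g : locTorus L⁺ L i) : unitAt (RestrictedProduct.mulSingle (genLevel L) i g) j = 1 := by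
  simp [unitAt, RestrictedProduct.mulSingle_eq_of_ne _ _ h]

/-- almost every split component of `k` is a UNIT of norm one (`k_v ∈ B_v` for almost all `v`) -/
theorem eventually_norm_unitAt_eq_one (k : Model L) :
    ∀ᶠ i : SplitIdx L in cofinite, ‖((unitAt k i : ((basePlaceOf L i.1).adicCompletion L⁺)ˣ) :
      (basePlaceOf L i.1).adicCompletion L⁺)‖ = 1 := by
  have h := (Subtype.val_injective (p := fun i : Place L⁺ => IsSplitPlace L i)).tendsto_cofinite.eventually k.2
  filter_upwards [h] with i hi
  exact (mem_genLevel_iff_norm_baseTriv_eq_one L i.1 i.2 (k i.1)).1 hi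

/-- (Ported verbatim from the HodgeCMPerL package; no docstring in the source.) -/
theorem eventually_mapsTo_smul (k : Model L) :
    ∀ᶠ i : SplitIdx L in cofinite, MapsTo (fun y : Coord L i =>
      ((unitAt k i : ((basePlaceOf L i.1).adicCompletion L⁺)ˣ) : (basePlaceOf L i.1).adicCompletion L⁺) • y)
      (cube L i : Set (Coord L i)) (cube L i : Set (Coord L i)) := by
  filter_upwards [eventually_norm_unitAt_eq_one k] with i hi y hy
  rw [SetLike.mem_coe, mem_cube_iff] at hy ⊢
  rw [norm_smul, hi, one_mul]
  exact hy

/-- `(k • x)_v = baseTriv(k_v) · x_v`: the model group acts on `X` coordinatewise through the base charts -/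
instance instSMul : SMul (Model L) (Space L) where
  smul k x := RestrictedProduct.mapAlong (Coord L) (Coord L) id tendsto_id
    (fun i (y : Coord L i) =>
      ((unitAt k i : ((basePlaceOf L i.1).adicCompletion L⁺)ˣ) : (basePlaceOf L i.1).adicCompletion L⁺) • y)
    (eventually_mapsTo_smul k) x

/-- (Ported verbatim from the HodgeCMPerL package; no docstring in the source.) -/
theorem smul_apply (k : Model L) (x : Space L) (i : SplitIdx L) :
    (k • x) i = ((unitAt k i : ((basePlaceOf L i.1).adicCompletion L⁺)ˣ) :
      (basePlaceOf L i.1).adicCompletion L⁺) • x i := rfl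

/-- (Ported verbatim from the HodgeCMPerL package; no docstring in the source.) -/
instance instMulAction : MulAction (Model L) (Space L) where
  one_smul x := by ext i; rw [smul_apply, unitAt_one, Units.val_one, one_smul]
  mul_smul k k' x := by ext i; rw [smul_apply, smul_apply, smul_apply, unitAt_mul, Units.val_mul, mul_smul]

/-- (Ported verbatim from the HodgeCMPerL package; no docstring in the source.) -/
instance instDistribMulAction : DistribMulAction (Model L) (Space L) where
  smul_zero k := by ext i; simp only [smul_apply, RestrictedProduct.zero_apply, smul_zero]
  smul_add k x y := by ext i; simp only [smul_apply, RestrictedProduct.add_apply, smul_add]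

/-- (Ported verbatim from the HodgeCMPerL package; no docstring in the source.) -/
theorem continuous_smulCoord (k : Model L) (i : SplitIdx L) : Continuous (fun y : Coord L i =>
    ((unitAt k i : ((basePlaceOf L i.1).adicCompletion L⁺)ˣ) : (basePlaceOf L i.1).adicCompletion L⁺) • y) :=
  continuous_const_smul _

/-- (Ported verbatim from the HodgeCMPerL package; no docstring in the source.) -/
instance instContinuousConstSMul : ContinuousConstSMul (Model L) (Space L) where
  continuous_const_smul k := RestrictedProduct.mapAlong_continuous (Coord L) (Coord L) id tendsto_id _
    (eventually_mapsTo_smul k) (fun i => continuous_smulCoord k i)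

variable (L) in
/-- **the global split Schrödinger representation** of `U(1)(𝔸_{L⁺})` on `L²(X)`: `(ω(k) f)(x) = ν(k) δ(k)^{1/2} f(k • x)`
(pv07-g2's `dilationRep` for the action of §2; `ν` a unitary character of the model group). -/
abbrev rep (ν : Model L →* Circle) : Model L →* (Lp ℂ 2 (μ L) ≃ₗᵢ[ℂ] Lp ℂ 2 (μ L)) := dilationRep (μ L) ν

/-- (Ported verbatim from the HodgeCMPerL package; no docstring in the source.) -/
@[simp] theorem unitAt_inv (k : Model L) (i : SplitIdx L) : unitAt k⁻¹ i = (unitAt k i)⁻¹ := by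
  simp [unitAt]

/-! ## §3  Slices: `dx` restricted to the cylinder over `v` and pushed to the `v`-coordinate IS `dx_v` -/

section Slice

variable [∀ v : HeightOneSpectrum (𝓞 (maximalRealSubfield L)), MeasurableSpace (v.adicCompletion (maximalRealSubfield L))]
  [∀ v : HeightOneSpectrum (𝓞 (maximalRealSubfield L)), BorelSpace (v.adicCompletion (maximalRealSubfield L))]

variable (L) in
/-- the cylinder over the `i`-th coordinate: `(L⁺_v)³ × ∏_{w ≠ v} 𝒪_w³ ⊂ X` (open) -/
def cyl (i : SplitIdx L) : Set (Space L) := {x | ∀ j, j ≠ i → x.1 j ∈ (cube L j : Set (Coord L j))}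

/-- (Ported verbatim from the HodgeCMPerL package; no docstring in the source.) -/
theorem isOpen_cyl (i : SplitIdx L) : IsOpen (cyl L i) :=
  RestrictedProduct.isOpen_forall_imp_mem (fact_isOpen_cube L).out

/-- (Ported verbatim from the HodgeCMPerL package; no docstring in the source.) -/
theorem measurableSet_cyl (i : SplitIdx L) : MeasurableSet (cyl L i) := (isOpen_cyl i).measurableSet

/-- (Ported verbatim from the HodgeCMPerL package; no docstring in the source.) -/
theorem mem_cyl_iff (i : SplitIdx L) (x : Space L) : x ∈ cyl L i ↔ ∀ j, j ≠ i → x j ∈ cube L j := Iff.rfl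

/-- (Ported verbatim from the HodgeCMPerL package; no docstring in the source.) -/
theorem continuous_eval (i : SplitIdx L) : Continuous (fun x : Space L => x i) :=
  RestrictedProduct.continuous_eval i

/-- (Ported verbatim from the HodgeCMPerL package; no docstring in the source.) -/
theorem measurable_eval (i : SplitIdx L) : Measurable (fun x : Space L => x i) := (continuous_eval i).measurable

/-- (Ported verbatim from the HodgeCMPerL package; no docstring in the source.) -/
theorem box_eq_cyl_inter (i : SplitIdx L) :
    (box L : Set (Space L)) = cyl L i ∩ (fun x => x i) ⁻¹' (cube L i : Set (Coord L i)) := by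
  ext x
  simp only [coe_box, mem_setOf_eq, mem_inter_iff, mem_cyl_iff, mem_preimage, SetLike.mem_coe]
  refine ⟨fun h => ⟨fun j _ => h j, h i⟩, fun h j => ?_⟩
  by_cases hj : j = i
  · exact hj ▸ h.2
  · exact h.1 j hj

variable (L) in
/-- the slice measure at `v`: `dx|_{cyl v}` pushed forward to the `v`-coordinate -/
def sliceMeasure (i : SplitIdx L) : Measure (Coord L i) := ((μ L).restrict (cyl L i)).map (fun x => x i)

/-- (Ported verbatim from the HodgeCMPerL package; no docstring in the source.) -/
theorem sliceMeasure_apply (i : SplitIdx L) {A : Set (Coord L i)} (hA : MeasurableSet A) :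
    sliceMeasure L i A = μ L (cyl L i ∩ (fun x => x i) ⁻¹' A) := by
  rw [sliceMeasure, Measure.map_apply (measurable_eval i) hA, Measure.restrict_apply' (measurableSet_cyl i),
    inter_comm]

/-- (Ported verbatim from the HodgeCMPerL package; no docstring in the source.) -/
theorem sliceMeasure_cube (i : SplitIdx L) : sliceMeasure L i (cube L i : Set (Coord L i)) = 1 := by
  rw [sliceMeasure_apply i (cube L i).isOpen.measurableSet, ← box_eq_cyl_inter]
  exact μ_box L

variable [DecidableEq (Place (maximalRealSubfield L))]

/-- the coordinate embedding `a ↦ (…, 0, a, 0, …)` of `(L⁺_v)³` into `X` -/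
def emb (i : SplitIdx L) (a : Coord L i) : Space L := RestrictedProduct.single (cube L) i a

/-- (Ported verbatim from the HodgeCMPerL package; no docstring in the source.) -/
@[simp] theorem emb_apply_self (i : SplitIdx L) (a : Coord L i) : emb i a i = a := by
  simp [emb]

/-- (Ported verbatim from the HodgeCMPerL package; no docstring in the source.) -/
theorem emb_apply_of_ne (i : SplitIdx L) (a : Coord L i) {j : SplitIdx L} (h : j ≠ i) : emb i a j = 0 := by
  simp [emb, RestrictedProduct.single_eq_of_ne _ _ h]

/-- (Ported verbatim from the HodgeCMPerL package; no docstring in the source.) -/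
theorem preimage_add_emb_cyl (i : SplitIdx L) (a : Coord L i) :
    (fun x => emb i a + x) ⁻¹' cyl L i = cyl L i := by
  ext x
  simp only [mem_preimage, mem_cyl_iff, RestrictedProduct.add_apply]
  refine forall₂_congr fun j hj => ?_
  rw [emb_apply_of_ne i a hj, zero_add]

/-- the slice measure is translation invariant (translate inside `X` by `emb a`, which preserves the cylinder) -/
instance isAddLeftInvariant_sliceMeasure (i : SplitIdx L) : (sliceMeasure L i).IsAddLeftInvariant := by
  refine ⟨fun a => ?_⟩
  rw [sliceMeasure, Measure.map_map (measurable_const_add a) (measurable_eval i)]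
  have hcomp : ((fun y : Coord L i => a + y) ∘ fun x : Space L => x i) =
      (fun x : Space L => x i) ∘ fun x => emb i a + x := by
    funext x
    simp only [Function.comp_apply, RestrictedProduct.add_apply, emb_apply_self]
  rw [hcomp, ← Measure.map_map (measurable_eval i) (measurable_const_add _)]
  congr 1
  have h := Measure.restrict_map (μ := μ L) (measurable_const_add (emb i a)) (measurableSet_cyl i)
  rw [preimage_add_emb_cyl, map_add_left_eq_self] at h
  exact h.symm

/-- the slice measure is finite on compact sets (a compact `C ⊂ (L⁺_v)³` is covered by finitely many translates
`c + 𝒪_v³`, so the slice over `C` by finitely many translates of the box) -/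
instance isFiniteMeasureOnCompacts_sliceMeasure (i : SplitIdx L) : IsFiniteMeasureOnCompacts (sliceMeasure L i) := by
  refine ⟨fun C hC => ?_⟩
  rw [sliceMeasure_apply i hC.measurableSet]
  obtain ⟨F, hF⟩ := hC.elim_finite_subcover (fun c : Coord L i => (fun y => c + y) '' (cube L i : Set (Coord L i)))
    (fun c => (isOpenMap_add_left c) _ (cube L i).isOpen)
    (fun c hc => mem_iUnion.2 ⟨c, ⟨0, zero_mem (cube L i), add_zero c⟩⟩)
  have hsub : cyl L i ∩ (fun x => x i) ⁻¹' C ⊆ ⋃ c ∈ F, (fun x => -emb i c + x) ⁻¹' (box L : Set (Space L)) := by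
    rintro x ⟨hx, hxC⟩
    obtain ⟨c, hcF, y, hy, hcy⟩ : ∃ c ∈ F, ∃ y ∈ (cube L i : Set (Coord L i)), c + y = x i := by
      simpa only [mem_iUnion, mem_image, exists_prop] using hF hxC
    refine mem_iUnion₂.2 ⟨c, hcF, ?_⟩
    rw [mem_preimage, mem_box_iff]
    intro j
    by_cases hj : j = i
    · subst hj
      rw [RestrictedProduct.add_apply, RestrictedProduct.neg_apply, emb_apply_self, ← hcy, neg_add_cancel_left]
      exact hy
    · rw [RestrictedProduct.add_apply, RestrictedProduct.neg_apply, emb_apply_of_ne i c hj, neg_zero, zero_add]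
      exact hx j hj
  refine lt_of_le_of_lt (measure_mono hsub) ?_
  refine lt_of_le_of_lt (measure_biUnion_finset_le F _) ?_
  simp only [measure_preimage_add, μ_box]
  exact ENNReal.sum_lt_top.2 fun _ _ => ENNReal.one_lt_top

/-- **`dx|_{cyl v}` pushed to the `v`-coordinate is `dx_v`** (both are Haar on `(L⁺_v)³` giving `𝒪_v³` measure one) -/
theorem sliceMeasure_eq_muV (i : SplitIdx L) : sliceMeasure L i = Adic.muV L⁺ (basePlaceOf L i.1) := by
  rw [Adic.muV]
  exact ((addHaarMeasure_eq_iff _ _).2 (sliceMeasure_cube i)).symm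

/-- **the `v`-coordinate is measure preserving** from `(cyl v, dx)` to `((L⁺_v)³, dx_v)` -/
theorem measurePreserving_eval (i : SplitIdx L) :
    MeasurePreserving (fun x : Space L => x i) ((μ L).restrict (cyl L i)) (Adic.muV L⁺ (basePlaceOf L i.1)) :=
  ⟨measurable_eval i, sliceMeasure_eq_muV i⟩


-- port_pkg: scope closed for this part
end Slice
end SchrodingerModel
end HodgeCM.PerL34.PureTensor
end
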